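import Literature.AlgebraicGeometry.AbelianSchemes.DualPairBaseQuotientDescent
import Literature.AlgebraicGeometry.AbelianSchemes.AbelianSchemeKOfL
import Literature.AlgebraicGeometry.AbelianSchemes.AbelianSchemeDualPairNormalize
import Literature.AlgebraicGeometry.Morphisms.ProjectiveMorphismComposition
import Literature.AlgebraicGeometry.AbelianSchemes.MumfordQuotientConstruction              -- ★ p792645 (Mb) closer (B-p16 (g18)); ed. 5
import Literature.AlgebraicGeometry.AbelianSchemes.DualPairHatActionOfBaseChangeSquares    -- ★ (Md1) closer `DualPair.exists_actionOver_hat_of_isBaseChangeVia` (B-p13 (g21) E6); ed. 5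
import Literature.AlgebraicGeometry.AbelianSchemes.AbelianSchemeBaseQuotientDescentOfAffineBase  -- ★ p788903 (Md2) closer `exists_abelianScheme_desc_of_forall_finset` (B-p13 E4); ed. 5
import Literature.AlgebraicGeometry.AbelianSchemes.DualPairBaseQuotientDescentOfNoetherian  -- ★ (Md3) closer `exists_dualPair_fields_of_free_base_quotient'` (B-p13 E3); ed. 5
import Literature.AlgebraicGeometry.AbelianSchemes.LevelBasisCoverFreeQuotient               -- ★ p794591 (Ma0) closer `exists_levelBasisCover_free_geometricQuotient_of_algebra_rat` (B-p02 (g16) ∕ B-p19 (g18)); ed. 6a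
import Summits.HodgeConjecture.HodgeConjecture.Theorems.F3DualAbelianSchemeMStubMa                -- ★ p795118 (Ma) closer `…HypDel.F3DualAbelianSchemeM.stub_F3Ma_holds` (B-p19 (g18)); ed. 6b
import Summits.HodgeConjecture.HodgeConjecture.Theorems.F3DualAbelianSchemeMStubMc                -- ★ p797599 T2 (Mc) closer `…Cruxes.HypDel.F3DualAbelianSchemeM.stub_F3Mc_holds` (B-p02 (g17)); ed. 7
import HarnessLib

/-!
# F-3 (M) CHILD LINE `Cruxes/HDel/Lines/F3DualAbelianSchemeM` — skeleton v0 ed. 4 (typed by B-typ04 (g15) on B-plan1 (g19)'s cut;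
# B-plan1 (g19) 19:18:18Z: «TAKEN AS THE (M) CHILD LINE»; HOME-only until the `crux write` (R3) by B-plan2 ∕ B-plan1; 0 names booked)

HC_CM is proved only modulo the 7 printed citations until rung 0 closes; nothing in this file is about HC.

PARENT: tree `Summits/HodgeConjecture/HodgeConjecture/Cruxes/HDel/Lines/F3DualAbelianScheme.lean` ed. 1.2 (B-plan1 (g19) 19:29:45Z ∕ 19:36:14Z: `stub_F3M`
gains `[ConnectedSpace ↥(Spec (.of R))]` after `[Algebra ℚ R]` and `(_hA : IsProjective A.X.hom)` right after `(A : …)`; ed. 1 was 17224f58),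
stub (M) `stub_F3M`
(«Mumford's construction `Â := A ⁄ K(L)` over a Noetherian affine `ℚ`-base has a dual pair» — the HARDEST stub of the F-3 sub-line).
The parent file stays byte-stable; this CHILD LINE proves its letter as `stub_F3M_holds` (statement VERBATIM) from SEVEN second-layer
stubs, so provers target `Summit.HodgeConjecture.CorCM.Cruxes.HypDel.F3DualAbelianSchemeM.stub_F3M{a0,a,b,c,d1,d2,d3}` by name
(`--supports stmt-HodgeConjecture-24835`) and the parent's closing prover writes `exact F3DualAbelianSchemeM.stub_F3M_holds`.
CUT = B-plan1 (g19) `F0/P1/Lines/F3DualAbelianScheme.M-cut.v0.md` v0.1 e9a22f2a ((M-a)…(M-d) + CARRIER DECISION: free base action in the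
carrier OF RECORD `(ρ : RelativeSpec.ActionOver p G) (hq : ρ.IsGeometricQuotient p) [IsAffineHom p] (hfree …)` of ★
`DualPairBaseQuotientDescent.lean:97–100`, cover = the level-`m`-basis cover); censuses: B-typ04 `typers/CENSUS-F3-construction-treehas`
8f692e78 (§6 carrier), B-p16 (g18) `CENSUS-F3Mb-ConstantKQuotientPoincare` e285097c (road R), B-p13 (g21) (E1)–(E3) leaves (HOME GREEN).

STUBS, in the order of the composition (each a closed `∀ …, ∃ …` over ★ carriers; typer lint: no `def`/`structure`/`instance`/notation):
* (Ma0) `stub_F3Ma0` — the LEVEL-`m`-BASIS cover as a free `GL_{2g}(ℤ/m)`-quotient of the base (carrier package; ∅ in tree: ★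
  `LevelBasisFiniteEtaleCover.exists_finite_etale_levelStructure` gives the finite étale cover and the level structure, NOT the action ∕
  freeness ∕ quotient clauses).  Consumed by the PROOF of (Ma), not by the composition.
* (Ma)  `stub_F3Ma` — ÉTALE-LOCAL CONSTANCY of `K(L)`: a free finite base quotient `p : S′ → Spec R` over which `K(p^*L)` is the CONSTANT
  subgroup scheme on a finite subgroup `K′` of sections (the form ★ `quotientBy` eats), delivered with the canonical base-change action on
  `A′ = A ×_R S′`, the instance facts the descent consumes, and (ed. 3) the FREENESS clause «`K′` injects into every geometric fibre»
  (hypothesis shape of ★ `forall_comp_translation_ne_of_forall_restrict_ne`, B-p16 (g18) 19:29:16Z (β)); (ed. 4) under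
  `[ConnectedSpace ↥(Spec (.of R))]` — WITHOUT it the letter is FALSE (B-p19 (g18) 19:34:46Z witness `R = ℚ × ℚ`, `A = E ⊔ E`,
  `L = 𝒪(0) ⊔ 𝒪(3·0)`: `K(L) = 1 ⊔ E[3]`, no finite `K′` is both fibrewise injective and constant for `K(L′)`); over a CONNECTED
  Noetherian affine base `#K(L_s̄)` is constant and `K′` is glued across the components of the torsor `S′` along the `G`-action
  (B-p19's (r2); B-plan1 (g19) 19:36:14Z ruling: the connectedness binder is DELIVERED by the parent's (L) chart shrink, parent ed. 1.2).
* (Mb)  `stub_F3Mb` — over `S′` (ed. 3: WITH `(_hA' : IsProjective (A.baseChange p).X.hom)` and the freeness clause `_hKinj` as hypotheses, B-p16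
  19:29:16Z ∕ B-plan1 19:29:45Z (α)+(β); ed. 4: `[ConnectedSpace ↥(Spec (.of R))]` also available here, free in the composition): the quotient `π : A′ → Â′ := A′/K′` and the descended, re-rigidified Mumford bundle `𝒫′` with the three
  property fields `hasRank_one`/`rigid`/`fibrewisePicZero` of ★ `DualPair`, the KERNEL clause of `π`, the (M-c) SOCKET `(1 × π)^*𝒫′ ≅ Λ(L′)`
  (B-p16 road R) and «finite sets of points of `Â′` lie in affine opens».
* (Mc)  `stub_F3Mc` — UNIVERSALITY of `(Â′, 𝒫′)` over ALL `T → S′`, conclusion = the field `DualPair.universal` of ★ `AbelianSchemeDualPair`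
  VERBATIM in shape, from exactly (Mb)'s clauses.  THE NEW CONTENT ∕ HARDEST.
* (Md1) `stub_F3Md1` — the `G`-ACTION ON THE (hat-normalised) DUAL `Â′` covering `ρ`, group-scheme squares, Poincaré invariance `hP` —
  from dual-pair uniqueness (★ `DualTransport*`).
* (Md2) `stub_F3Md2` — OBJECT DESCENT (d2): `Â′/G =: B̂` is an abelian scheme over the AFFINE `Q` (`[IsAffine Q]`, ed. 19:19Z) with `Â′` its
  base change (price-sheet LACK (Q2c), cheapest Galois ∕ free-quotient form) — CLOSED IN HOME by B-p13 (g21) over (E4) (slot test 3b0a228b).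
* (Md3) `stub_F3Md3` — FIELDS DESCEND (d1)+(d3) = B-p13 (g21)'s (E3) `exists_dualPair_fields_of_free_base_quotient′` §1 letter VERBATIM
  (★ `exists_dualPair_fields_of_free_base_quotient` with `[IsReduced D.hat.X.left] [IsLocallyNoetherian D.hat.X.left]` replaced by
  `[IsLocallyNoetherian S]`; GREEN zero-sorry in HOME `B-provers/B-p13/g21/F3Md/`, over the (Z2) seed) — discharged BY NAME when (E3) lands.
* §8 `stub_F3M_of` — the COMPOSITION, PROVED (22 tactic lines: `D′ := ⟨Â′, 𝒫′, h1, hrig, hpic, (Mc)⟩`, `D := D′.normalize` (★, unit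
  hypothesis ★ `nonempty_unitHatSlice_iso_normalize`), (Md1), (Md2), `ρ̂′ := ⟨ρ̂.aut, invariance⟩`, (Md3), `⟨B̂, 𝒫_B, …⟩`); HEAD
  `stub_F3M_holds` = the TREE statement of `stub_F3M` token for token := `stub_F3M_of`.

`lean check --json --no-snap --axioms …F3DualAbelianSchemeM.stub_F3M_holds`: rc 0 ∕ errors [] ∕ warnings = the 7 letter `sorry`s only ∕
axioms [propext, sorryAx, Classical.choice, Quot.sound]; planted-error canary in (Md1) ⇒ rc 1.  Imports = 3 ★ `AbelianSchemes` modules +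
HarnessLib (none below the L11 leg; the parent Lines file is NOT imported — the head is restated verbatim instead).

GAPS surfaced while typing (for the card): (G5) `IsCommMonObj A.X` over a NON-REDUCED locally Noetherian base (★ only for reduced ∕ smooth
bases ∕ fields: `AbelianSchemeOverCommOfReduced`; = MFK Cor. 6.5 from ★ `rigidity_of_isLocallyNoetherian`, S-sized) — the stubs do NOT bind
`[IsCommMonObj A.X]` (true statements; the provers derive it); (G6) `A.IsOfRelDim g` exists only per connected component of `Spec R`
((Ma0) binds `g`; (Ma) does not expose it).

EDITION 6a (B-p11 (g21) on B-plan1 (g20)'s (M) edition book 23:10:04Z; pen inherited from B-p10 (g14) ■ 23:06:24Z): (Ma0) `stub_F3Ma0`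
CLOSED BY NAME over ★ p794591 `AbelianSchemes/LevelBasisCoverFreeQuotient` (`AbelianSchemeOver.exists_levelBasisCover_free_geometricQuotient_of_algebra_rat`,
author B-p02 (g16), filer B-p19 (g18)) — its letter token for token, so the body is `intro …; exact …`.  `sorry` census: TWO =
{`stub_F3Ma` (closer `Theorems/F3DualAbelianSchemeMStubMa`, B-p19 (g18)), `stub_F3Mc` (T2 `Theorems/F3DualAbelianSchemeMStubMc`, B-p02 (g17))};
(Mb) ∕ (Md1)–(Md3) by name since ed. 5; all nine decl statements byte-identical to ed. 5 43cf8b993de528f9; head `stub_F3M_holds` axioms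
trio ⊕ `sorryAx`, `stub_F3Ma0` axioms trio.  ed. 6b = + `stub_F3Ma := …stub_F3Ma_holds` the minute its Theorems closer is ★.

EDITION 6b (B-p11 (g21), (M) edition pen per B-plan1 (g20) 23:20:14Z): (Ma) `stub_F3Ma` CLOSED BY NAME over ★ p795118
`Theorems/F3DualAbelianSchemeMStubMa` (`Summit.HodgeConjecture.CorCM.HypDel.F3DualAbelianSchemeM.stub_F3Ma_holds`, B-p19 (g18); its head is
the ed. 4 letter token for token, so the body is a bare `exact` of the ★ constant — the closer lives in the sibling namespace without
`.Cruxes.`, hence no FQN clash with this workfile).  `sorry` census: ONE = {`stub_F3Mc` (T2 `Theorems/F3DualAbelianSchemeMStubMc`, B-p02 (g17),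
staged df7fb26c modulo T1)}; all nine decl statements byte-identical to ed. 6a 6cafd20add0a4683; head `stub_F3M_holds` axioms trio ⊕ `sorryAx`,
`stub_F3Ma` axioms trio.  ed. 7 = + `stub_F3Mc := …stub_F3Mc_holds` when T2 is ★ ⇒ the (M) child line is sorry-free and T3 files.

EDITION 7 (B-p11 (g21), (M) edition pen): (Mc) `stub_F3Mc` CLOSED BY NAME over ★ T2 `Theorems/F3DualAbelianSchemeMStubMc`
(`Summit.HodgeConjecture.CorCM.Cruxes.HypDel.F3DualAbelianSchemeM.stub_F3Mc_holds`, (Mc) lead B-p02 (g17), over T2a `Theorems/F3DualAbelianSchemeMcLetters`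
and T1 `Theorems/F3DualAbelianSchemeMcStubN3`; its head is the ed. 4 (Mc) letter token for token, so the body is a bare `exact`).  `sorry` census:
ZERO — THE (M) CHILD LINE IS SORRY-FREE; all nine decl statements byte-identical to ed. 6b 33a0a611c04a2c65; `#print axioms stub_F3M_holds` =
[propext, Classical.choice, Quot.sound].  The parent's `stub_F3M` closes by T3 `Theorems/F3DualAbelianSchemeStubM` (same content re-homed, B-p10 (g14)
bytes, B-p11 filer) at parent ed. 1.6.
-/

noncomputable section

open CategoryTheory CategoryTheory.Limits AlgebraicGeometry MonoidalCategory CartesianMonoidalCategory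
open scoped MonObj
open Literature.AlgebraicGeometry.AbelianSchemes Literature.AlgebraicGeometry.RelativeSpec
  Literature.AlgebraicGeometry.Motives Literature.AlgebraicGeometry.AbelianVarieties Literature.AlgebraicGeometry.Modules
open Literature.AlgebraicGeometry.Morphisms (IsProjective)

namespace Summit.HodgeConjecture.CorCM.Cruxes.HypDel.F3DualAbelianSchemeM

/-! ## §1 (Ma0) — the level-`m`-basis cover as a FREE FINITE BASE QUOTIENT (carrier package) -/

/-- **letter (Ma0) `stub_F3Ma0`** — [MumfordFogartyKirwan1994, Ch. 7 §2 Prop. 7.3 step (IV) (pp. 133–134)]: for an abelian scheme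
`A → Spec R` of relative dimension `g` over a Noetherian `ℚ`-algebra and `m ≥ 1`, the scheme of level-`m` bases
`Isom((ℤ/m)^{2g}, A[m])` is a finite étale cover `p : S′ → Spec R` carrying a FREE action of `GL_{2g}(ℤ/m)` (by re-basing) of
which `Spec R` is the geometric quotient, and `A ×_R S′` has a level-`m` structure — stated in the free-base-quotient carrier OF
RECORD (★ `DualPairBaseQuotientDescent.lean:97–100`).  Tree: ★ `LevelBasisFiniteEtaleCover.exists_finite_etale_levelStructure`
(+ `…Surjective`, `…Values`) gives `(S′, p, level structure)`; the action ∕ freeness ∕ quotient clauses are the ∅ package (M, 1–2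
files: ★ `GeometricQuotientRecognition.isGeometricQuotient_of_range_app`, ★ `GeometricQuotientFreeTorsor`).  Commutativity of `A`
((G5)) is used by the prover, not bound here. [cite: MumfordFogartyKirwan1994, Ch. 7 §2 Proposition 7.3, proof step (IV) (pp. 133–134)]
[cite: GortzWedhorn2023, Prop. 27.188 (1) (`X[n]` is finite étale and étale-locally constant for `n` invertible)] -/
theorem stub_F3Ma0 : ∀ (R : Type) [CommRing R] [IsNoetherianRing R] [Algebra ℚ R] (A : AbelianSchemeOver (Spec (.of R)))
    {g : ℕ} (_hg : A.IsOfRelDim g) (m : ℕ) [NeZero m],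
    ∃ (S' : Scheme.{0}) (p : S' ⟶ Spec (.of R)) (_ : IsAffine S') (_ : IsAffineHom p) (_ : IsFinite p) (_ : Etale p)
      (_ : Surjective p) (ρ : ActionOver p (Matrix.GeneralLinearGroup (Fin g ⊕ Fin g) (ZMod m))),
      ρ.IsGeometricQuotient p ∧
      (∀ (V : (Spec (.of R)).Opens), IsAffineOpen V → ∀ γ₀ : Matrix.GeneralLinearGroup (Fin g ⊕ Fin g) (ZMod m), γ₀ ≠ 1 →
        Ideal.span (Set.range fun s : Γ(S', p ⁻¹ᵁ V) ↦ ρ.act γ₀ V s - s) = ⊤) ∧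
      Nonempty (AbelianSchemeOver.LevelStructure g m (A.baseChange p)) := by
  intro R _ _ _ A g hg m _
  exact A.exists_levelBasisCover_free_geometricQuotient_of_algebra_rat R hg m

/-! ## §2 (Ma) — étale-local constancy of `K(L)` over a free finite base quotient -/

/-- **letter (Ma) `stub_F3Ma`** — «SPLIT THE FINITE ÉTALE `K(L)`»: in the situation of `stub_F3M` (rigidified rank-one `L` with
ample geometric fibre classes and `K(L)` represented by a finite étale closed subgroup scheme), there is a free finite base quotient
`p : S′ → Spec R = S′/G` (`S′` affine, `p` finite étale surjective affine; carrier of record) and a FINITE subgroup `K′` of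
sections of `A′ := A ×_R S′` such that `K(p^*L)` IS the constant subgroup scheme on `K′`: a `T`-point `u` of `A′` lies in
`K(p^*L)` iff it is, locally on `T`, the restriction of a section in `K′`; the cover is delivered WITH the (canonical) base-change
action `ρA = 1_A × ρ` on `A′` over `pr_A` and its two ★-shaped group-scheme clauses (★ `baseChange_isBaseChangeVia`; ★
`RelativeSpec.ActionOver.onPullback`), and with the instance facts `IsLocallyNoetherian S′`, `LocallyOfFiniteType p` the descent
(Md3) consumes — so the composition `stub_F3M_of` needs no further tree name.  Proof road (lead): (Ma0) with `m :=` the uniform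
exponent of the `K(L_s̄)` ((K) + ★ `pow_natCard_KTheta_eq_one_of_memKOfL`), `K(L) ⊆ A[m]` scheme-theoretically (∅, S), and «a
clopen subgroup subscheme of the constant `(ℤ/m)^{2g}` over a connected base is constant» (∅, S), per connected component of
`S′`. [cite: MumfordAV1970, §13 (p. 123) and §7 Thm. 4 (p. 72)] [cite: MumfordFogartyKirwan1994, Ch. 7 §2 Prop. 7.3 step (IV) (pp. 133–134)] -/
theorem stub_F3Ma : ∀ (R : Type) [CommRing R] [IsNoetherianRing R] [Algebra ℚ R] [ConnectedSpace ↥(Spec (.of R))]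
    (A : AbelianSchemeOver (Spec (.of R)))
    (L : A.left.Modules) (hL : HasRank L 1)
    (_hε : CechPic.pullback A.unitSection (detClass (HasRank.isFiniteLocallyFree' hL)) = 1)
    (_hΘ : ∀ ⦃Ω : Type⦄ [Field Ω] [IsAlgClosed Ω] (s : Spec (.of Ω) ⟶ Spec (.of R)),
      ∃ Θ : CartierDivisor (A.fibre s).toAbelianVariety.X.left, Θ.IsAmple ∧
        CechPic.pullback (X := (A.fibre s).toAbelianVariety.X.left) (pullback.fst A.X.hom s)
          (detClass (HasRank.isFiniteLocallyFree' hL)) = Θ.cechClass)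
    (_hK : ∃ (Z : Over (Spec (.of R))) (i : Z ⟶ A.X) (_ : IsClosedImmersion i.left) (_ : IsFinite Z.hom) (_ : Etale Z.hom),
      ∀ (T : Over (Spec (.of R))) (u : T ⟶ A.X), (∃ v : T ⟶ Z, v ≫ i = u) ↔ A.MemKOfL L u),
    ∃ (S' : Scheme.{0}) (p : S' ⟶ Spec (.of R)) (_ : IsAffine S') (_ : IsLocallyNoetherian S') (_ : IsAffineHom p)
      (_ : IsFinite p) (_ : LocallyOfFiniteType p) (_ : Etale p) (_ : Surjective p)
      (G : Type) (_ : Group G) (_ : Fintype G) (ρ : ActionOver p G)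
      (ρA : ActionOver (pullback.fst A.X.hom p) G) (_ : (A.baseChange p).IsBaseChangeVia A p (pullback.fst A.X.hom p))
      (_ : ∀ γ₀ : G, (A.baseChange p).IsBaseChangeVia (A.baseChange p) (ρ.aut γ₀).hom (ρA.aut γ₀).hom),
      ρ.IsGeometricQuotient p ∧
      (∀ (V : (Spec (.of R)).Opens), IsAffineOpen V → ∀ γ₀ : G, γ₀ ≠ 1 →
        Ideal.span (Set.range fun s : Γ(S', p ⁻¹ᵁ V) ↦ ρ.act γ₀ V s - s) = ⊤) ∧
      ∃ (K' : Subgroup (A.baseChange p).Sections) (_ : Finite K'),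
        (∀ (Ω : Type) [Field Ω] [IsAlgClosed Ω] (s : Spec (.of Ω) ⟶ S') (σ : (A.baseChange p).Sections), σ ∈ K' → σ ≠ 1 →
          (A.baseChange p).restrict s σ ≠ (A.baseChange p).restrict s 1) ∧
        ∀ (T : Over S') (u : T ⟶ (A.baseChange p).X),
          (A.baseChange p).MemKOfL ((Scheme.Modules.pullback (pullback.fst A.X.hom p)).obj L) u ↔
            ∃ 𝒱 : Scheme.OpenCover.{0} T.left, ∀ j, ∃ σ : K',
              𝒱.f j ≫ u.left = 𝒱.f j ≫ T.hom ≫ (σ : (A.baseChange p).Sections).left := by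
  exact Summit.HodgeConjecture.CorCM.HypDel.F3DualAbelianSchemeM.stub_F3Ma_holds

/-! ## §3 (Mb) — over `S′`: the quotient `Â′ := A′/K′`, the descended re-rigidified Mumford bundle, three fields, kernel clause, socket -/

/-- **letter (Mb) `stub_F3Mb`** — [MumfordAV1970, §13 Theorem (p. 125), construction half] RELATIVE to an affine base `S′` (finite
étale over the Noetherian `ℚ`-algebra `R`): for `A′ := A ×_R S′`, `L′ := L|_{A′}` and a FINITE subgroup `K′` of sections of `A′`
on which `K(L′)` is the constant subgroup scheme ((Ma)'s clause), there are an abelian scheme `Â′ → S′`, a homomorphism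
`π : A′ → Â′` over `S′` that is finite étale surjective with KERNEL `K(L′)` (functor-of-points clause), and a rank-one `𝒫′` on
`A′ ×_{S′} Â′`, rigidified along `ε × 1` and fibrewise in `Pic⁰` (the three PROPERTY fields `hasRank_one`/`rigid`/`fibrewisePicZero`
of ★ `DualPair`, same spelling), with the (M-c) SOCKET `(1_{A′} × π)^*𝒫′ ≅ Λ(L′)` (★ `mumfordBundle`).  Road R (B-p16 (g18) census
e285097c): `Â′ := ★ quotientBy` (constant `K′`; `hcov` from quasi-projectivity of `A′` via `L′`, `hfree` from the level/torsion
clause, `hG`/`hsm`/`hgc` ★ dischargers), `𝒫′ :=` ★ T1/(β) descent of `Λ(L′)` along `1 × π` for the free quotient ★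
`prodTranslationActionOver` with the `K′`-structure from the stabiliser clause «`σ ∈ K(L′) ⇒ (1 × t_σ)^*Λ ≅ Λ`» ((b1)(b1′)(b2) of the
census, over B-p13 (g21)'s (E1)), then ★ `RigidifyAlongUnitSlice` (which keeps the socket: ★ `nonempty_pullback_whiskerLeft_rigidify_iso`).
Last conjunct («every finite set of points of `Â′` lies in an affine open» = quasi-projectivity of `Â′` over the AFFINE `S′`, from
the relatively ample `L′` through the finite `π`): the object-descent letter (Md2) consumes it (stable affine opens for any finite
group action, ★ `AbelianSchemeConstSubgroupStableCover.forall_exists_mem_stableAffineOpens_of_orbit` pattern).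
[cite: MumfordAV1970, §13 Theorem (p. 125) and §12 Thm. 1 (p. 112)] [cite: MumfordFogartyKirwan1994, Ch. 6 §2 (p. 121)] -/
theorem stub_F3Mb : ∀ (R : Type) [CommRing R] [IsNoetherianRing R] [Algebra ℚ R] [ConnectedSpace ↥(Spec (.of R))]
    (A : AbelianSchemeOver (Spec (.of R)))
    (L : A.left.Modules) (hL : HasRank L 1)
    (_hε : CechPic.pullback A.unitSection (detClass (HasRank.isFiniteLocallyFree' hL)) = 1)
    (_hΘ : ∀ ⦃Ω : Type⦄ [Field Ω] [IsAlgClosed Ω] (s : Spec (.of Ω) ⟶ Spec (.of R)),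
      ∃ Θ : CartierDivisor (A.fibre s).toAbelianVariety.X.left, Θ.IsAmple ∧
        CechPic.pullback (X := (A.fibre s).toAbelianVariety.X.left) (pullback.fst A.X.hom s)
          (detClass (HasRank.isFiniteLocallyFree' hL)) = Θ.cechClass)
    {S' : Scheme.{0}} [IsAffine S'] (p : S' ⟶ Spec (.of R)) [IsFinite p] [Etale p] [Surjective p]
    (_hA' : IsProjective (A.baseChange p).X.hom)
    (K' : Subgroup (A.baseChange p).Sections) [Finite K']
    (_hKinj : ∀ (Ω : Type) [Field Ω] [IsAlgClosed Ω] (s : Spec (.of Ω) ⟶ S') (σ : (A.baseChange p).Sections),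
      σ ∈ K' → σ ≠ 1 → (A.baseChange p).restrict s σ ≠ (A.baseChange p).restrict s 1)
    (_hK' : ∀ (T : Over S') (u : T ⟶ (A.baseChange p).X),
      (A.baseChange p).MemKOfL ((Scheme.Modules.pullback (pullback.fst A.X.hom p)).obj L) u ↔
        ∃ 𝒱 : Scheme.OpenCover.{0} T.left, ∀ j, ∃ σ : K',
          𝒱.f j ≫ u.left = 𝒱.f j ≫ T.hom ≫ (σ : (A.baseChange p).Sections).left),
    ∃ (hat : AbelianSchemeOver S') (π : (A.baseChange p).X ⟶ hat.X) (_ : IsMonHom π)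
      (_ : IsFinite π.left) (_ : Etale π.left) (_ : Surjective π.left)
      (P : ((A.baseChange p).prodLeft hat).Modules),
      (∀ (T : Over S') (u : T ⟶ (A.baseChange p).X),
        u ≫ π = 1 ↔ (A.baseChange p).MemKOfL ((Scheme.Modules.pullback (pullback.fst A.X.hom p)).obj L) u) ∧
      HasRank P 1 ∧
      Nonempty ((Scheme.Modules.pullback ((A.baseChange p).unitSlice hat)).obj P ≅ SheafOfModules.unit _) ∧
      (∀ (Ω : Type) [Field Ω] [IsAlgClosed Ω] (b : Spec (.of Ω) ⟶ hat.X.left),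
        IsHomogeneous ((A.baseChange p).fibre (b ≫ hat.X.hom)).toAbelianVariety
          ((Scheme.Modules.pullback ((A.baseChange p).fibreSlice hat b)).obj P)) ∧
      Nonempty ((Scheme.Modules.pullback ((A.baseChange p).X ◁ π).left).obj P ≅
        (A.baseChange p).mumfordBundle ((Scheme.Modules.pullback (pullback.fst A.X.hom p)).obj L)) ∧
      (∀ F : Finset hat.X.left, ∃ U : hat.X.left.Opens, IsAffineOpen U ∧ ∀ x ∈ F, x ∈ U) := by
  intro R _ _ _ _ A L hL hε _hΘ S' _ p _ _ _ hA' K' _ hKinj hK'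
  haveI : IsLocallyNoetherian S' := LocallyOfFiniteType.isLocallyNoetherian p
  exact A.exists_quotient_poincare_of_constant_kOfL_baseChange
    (p ≫ Spec.map (CommRingCat.ofHom (algebraMap ℚ R))) hL hε p hA' K' hKinj hK'

/-! ## §4 (Mc) — UNIVERSALITY of `(Â′, 𝒫′)` over ALL `T → S′` (the new content; `DualPair.universal` shape) -/

/-- **letter (Mc) `stub_F3Mc` — THE HARDEST** — [MumfordAV1970, §13 Theorem (p. 125), universality half; MFK Ch. 6 §2 (p. 121)]:
for data as delivered by (Mb) — `π : A′ → Â′` a finite étale surjective homomorphism over `S′` whose kernel is `K(L′)` as a functor,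
and a rank-one `𝒫′` on `A′ × Â′` rigidified along `ε × 1` with `(1 × π)^*𝒫′ ≅ Λ(L′)` — the pair `(Â′, 𝒫′)` is UNIVERSAL in the
sense of the field `universal` of ★ `AbelianSchemeOver.DualPair` (same spelling): every rigidified fibrewise-`Pic⁰` line bundle on
`A′_T`, `T → S′` ANY scheme, is `(1 × g)^*𝒫′` for a unique `g : T → Â′` over `S′`.  Road (cut (M-c)): seesaw transporter closed ★,
étale-surjectivity on Artin points from the Lie count in characteristic `0` (ℂ-template ★ `Motives/PoincareUniversal/`, 21 files),
`K′`-torsor ⇒ graph, ★ fpqc descent of morphisms/rigidified isomorphisms, affine-finite-type-to-all.  Why it might fail: as typed the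
hypotheses determine `(Â′, 𝒫′)` up to isomorphism (rigidified families agreeing after the fpqc base change `π` agree), so the letter
is equivalent to print; the non-reduced-`T` deformation step has no ★ carrier outside `ℂ`.
[cite: MumfordAV1970, §13 Theorem (p. 125)] [cite: MumfordFogartyKirwan1994, Ch. 6 §2 (p. 121)] [cite: MilneAV2008, I §8 pp. 36–37] -/
theorem stub_F3Mc : ∀ (R : Type) [CommRing R] [IsNoetherianRing R] [Algebra ℚ R] (A : AbelianSchemeOver (Spec (.of R)))
    (L : A.left.Modules) (hL : HasRank L 1)
    (_hε : CechPic.pullback A.unitSection (detClass (HasRank.isFiniteLocallyFree' hL)) = 1)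
    (_hΘ : ∀ ⦃Ω : Type⦄ [Field Ω] [IsAlgClosed Ω] (s : Spec (.of Ω) ⟶ Spec (.of R)),
      ∃ Θ : CartierDivisor (A.fibre s).toAbelianVariety.X.left, Θ.IsAmple ∧
        CechPic.pullback (X := (A.fibre s).toAbelianVariety.X.left) (pullback.fst A.X.hom s)
          (detClass (HasRank.isFiniteLocallyFree' hL)) = Θ.cechClass)
    {S' : Scheme.{0}} [IsAffine S'] (p : S' ⟶ Spec (.of R)) [IsFinite p] [Etale p] [Surjective p]
    (hat : AbelianSchemeOver S') (π : (A.baseChange p).X ⟶ hat.X) [IsMonHom π]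
    (_hπ : IsFinite π.left ∧ Etale π.left ∧ Surjective π.left)
    (P : ((A.baseChange p).prodLeft hat).Modules)
    (_hker : ∀ (T : Over S') (u : T ⟶ (A.baseChange p).X),
      u ≫ π = 1 ↔ (A.baseChange p).MemKOfL ((Scheme.Modules.pullback (pullback.fst A.X.hom p)).obj L) u)
    (_h1 : HasRank P 1)
    (_hrig : Nonempty ((Scheme.Modules.pullback ((A.baseChange p).unitSlice hat)).obj P ≅ SheafOfModules.unit _))
    (_hsock : Nonempty ((Scheme.Modules.pullback ((A.baseChange p).X ◁ π).left).obj P ≅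
      (A.baseChange p).mumfordBundle ((Scheme.Modules.pullback (pullback.fst A.X.hom p)).obj L))),
    ∀ {T : Scheme.{0}} (f : T ⟶ S') (ℒ : (A.baseChange p).RigidifiedLineBundle f), ℒ.FibrewisePicZero →
      ∃! g : {g : T ⟶ hat.X.left // g ≫ hat.X.hom = f},
        Nonempty ((Scheme.Modules.pullback ((A.baseChange p).baseChangeToProd hat f g.1 g.2)).obj P ≅ ℒ.L) := by
  exact Summit.HodgeConjecture.CorCM.Cruxes.HypDel.F3DualAbelianSchemeM.stub_F3Mc_holds

/-! ## §5 (Md1) — the `G`-action on the dual covering `ρ`, from dual-pair uniqueness -/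

/-- **letter (Md1) `stub_F3Md1`** — [MilneAV2008, I §8 (the dual pair is unique up to a unique isomorphism)] in the free-base-quotient
carrier: `p : S → Q = S/G` free (carrier of record), `A/S` the base change of `B/Q` along `p` with the covering action `ρA` by
isomorphisms of group schemes (`hAB`, `hA`), and `D = (Â, 𝒫)` a HAT-NORMALISED dual pair of `A` (`𝒫|_{A × {ε_Â}} ≅ 𝒪`, ★
`DualPair.normalize`).  Then `G` acts on `Â` over `Â → S → Q`, covering `ρ` (`ρ̂(g)` over `ρ(g)`) by isomorphisms of group schemes,
with the POINCARÉ INVARIANCE clause `(ρA(g) × ρ̂(g))^*𝒫 ≅ 𝒫` for all `g` — exactly the inputs `ρh`/`hAh`/`hP` of (Md3).  Road: `ρ̂(g) :=`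
★ `DualPair.hatTransportOfBaseChange D D (hA g)` (FILE A `AbelianSchemeDualTransportOfBaseChange`: the transport along a base-change
square, its Poincaré clause `nonempty_pullback_map_hatTransportOfBaseChange_iso`, uniqueness ⇒ multiplicativity, group-scheme clause ★
`hat_isBaseChangeVia_hatTransportOfBaseChange_of_isLocallyNoetherian` under the unit hypothesis, or ★ `…OfBaseChangeAnyBase`).
[cite: MilneAV2008, I §8 pp. 36–37] [cite: MumfordFogartyKirwan1994, Ch. 6 §1 Cor. 6.4 (p. 117) and Ch. 7 §3 remark after Thm. 7.9 (p. 139)] -/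
theorem stub_F3Md1 : ∀ {S Q : Scheme.{0}} {p : S ⟶ Q} {G : Type} [Group G] [Fintype G] (ρ : ActionOver p G)
    (_hq : ρ.IsGeometricQuotient p) [IsAffineHom p]
    (_hfree : ∀ (V : Q.Opens), IsAffineOpen V → ∀ g : G, g ≠ 1 →
      Ideal.span (Set.range fun s : Γ(S, p ⁻¹ᵁ V) ↦ ρ.act g V s - s) = ⊤)
    (A : AbelianSchemeOver S) (D : A.DualPair)
    (B : AbelianSchemeOver Q) {π : A.X.left ⟶ B.X.left} (ρA : ActionOver π G) (_hAB : A.IsBaseChangeVia B p π)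
    (hA : ∀ g : G, A.IsBaseChangeVia A (ρ.aut g).hom (ρA.aut g).hom) [IsLocallyNoetherian S]
    (_unit : Nonempty ((Scheme.Modules.pullback (AbelianSchemeOver.DualPair.unitHatSlice D)).obj D.P ≅ SheafOfModules.unit _)),
    ∃ (ρh : ActionOver (D.hat.X.hom ≫ p) G) (_ : ∀ g : G, (ρh.aut g).hom ≫ D.hat.X.hom = D.hat.X.hom ≫ (ρ.aut g).hom)
      (hAh : ∀ g : G, D.hat.IsBaseChangeVia D.hat (ρ.aut g).hom (ρh.aut g).hom),
      ∀ g : G, Nonempty ((Scheme.Modules.pullback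
        (pullback.map A.X.hom D.hat.X.hom A.X.hom D.hat.X.hom (ρA.aut g).hom (ρh.aut g).hom (ρ.aut g).hom
          (hA g).fst.symm (hAh g).fst.symm)).obj D.P ≅ D.P) := by
  intro S Q p G _ _ ρ _ _ _ A D B π ρA _ hA _ hunit
  obtain ⟨ρh, -, hover, hAh, hP⟩ := AbelianSchemeOver.DualPair.exists_actionOver_hat_of_isBaseChangeVia ρ D ρA hA hunit
  exact ⟨ρh, hover, hAh, hP⟩

/-! ## §6 (Md2) — OBJECT DESCENT of the dual along the free base quotient (price-sheet LACK (Q2c), Galois form) -/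

/-- **letter (Md2) `stub_F3Md2`** — [SGA1, Exp. VIII Cor. 7.8 (effective descent of quasi-projective schemes)] in its cheapest,
free-finite-quotient form ([MumfordAV1970, §7 Thm. p. 66; §12 Thm. 1 (p. 112)]): `p : S → Q = S/G` a free finite base quotient (carrier
of record; `p` affine, locally of finite type; `S`, `Q` locally Noetherian, `Q` AFFINE — binder `[IsAffine Q]` added 19:19Z on B-p13 (g21)'s
closing over (E4) `exists_abelianScheme_desc_of_forall_finset`; the composition instantiates `Q := Spec R`), `X → S` an abelian scheme in which EVERY FINITE SET OF
POINTS LIES IN AN AFFINE OPEN (quasi-projective over an affine base suffices — (Mb)'s last conjunct), with a `G`-action `ρX` over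
`X → S → Q` covering `ρ` by isomorphisms of group schemes.  Then the quotient `X/G` is an ABELIAN SCHEME `B̂ → Q` with separated total
space, the quotient map `π̂ : X → B̂` is `G`-invariant and exhibits `X` as the base change of `B̂` along `p` as a group scheme.  Road:
`G`-stable affine cover (★ `forall_exists_mem_stableAffineOpens_of_orbit` pattern) ⇒ ★ `ActionOver.glued` / `isGeometricQuotient_gluedMk`
/ `isSeparated_gluedDesc` / `isProper_gluedDesc`; the group law, smoothness and geometric connectedness of `X/G → Q` descend because
`X → X/G` is a base change of the finite étale `S → Q` (★ `GeometricQuotientFreeBaseChange`, `GeometricQuotientGroupLaw`; cartesian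
square by ★ `isPullback_of_equivariant_of_free`).  New tree work (L−): the assembly «free quotient of an abelian scheme COVERING a free
base quotient is an abelian scheme over the quotient base» — the E-road ★ `AbelianSchemeBaseQuotientDescent` descends `A` when `B` is
GIVEN; here `B̂` is PRODUCED. [cite: SGA1, Exp. VIII Cor. 7.8] [cite: MumfordAV1970, §7 Thm. p. 66 and §12 Thm. 1 (p. 112)]
[cite: MumfordFogartyKirwan1994, Ch. 7 §3 remark after Thm. 7.9 (p. 139)] -/
theorem stub_F3Md2 : ∀ {S Q : Scheme.{0}} [IsAffine Q] {p : S ⟶ Q} {G : Type} [Group G] [Fintype G] (ρ : ActionOver p G)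
    (_hq : ρ.IsGeometricQuotient p) [IsAffineHom p] [LocallyOfFiniteType p] [IsLocallyNoetherian S] [IsLocallyNoetherian Q]
    (_hfree : ∀ (V : Q.Opens), IsAffineOpen V → ∀ g : G, g ≠ 1 →
      Ideal.span (Set.range fun s : Γ(S, p ⁻¹ᵁ V) ↦ ρ.act g V s - s) = ⊤)
    (X : AbelianSchemeOver S) (_hfin : ∀ F : Finset X.X.left, ∃ U : X.X.left.Opens, IsAffineOpen U ∧ ∀ x ∈ F, x ∈ U)
    (ρX : ActionOver (X.X.hom ≫ p) G) (_hρX : ∀ g : G, (ρX.aut g).hom ≫ X.X.hom = X.X.hom ≫ (ρ.aut g).hom)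
    (_hX : ∀ g : G, X.IsBaseChangeVia X (ρ.aut g).hom (ρX.aut g).hom),
    ∃ (Bh : AbelianSchemeOver Q) (πh : X.X.left ⟶ Bh.X.left),
      (∀ g : G, (ρX.aut g).hom ≫ πh = πh) ∧ X.IsBaseChangeVia Bh p πh ∧ Bh.X.left.IsSeparated := by
  intro S Q _ p G _ _ ρ hq _ _ _ _ hfree X hfin ρX _ hX
  haveI : IsSeparated p := IsSeparated.of_isAffineHom p
  obtain ⟨B, π, ρA, hρA, -, -, -, hsep, hbc⟩ :=
    AbelianSchemeOver.exists_abelianScheme_desc_of_forall_finset X ρX.aut hX hfin hq hfree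
  refine ⟨B, π, fun g => ?_, hbc, hsep⟩
  rw [← hρA g]
  exact ρA.aut_comp g

/-! ## §7 (Md3) — the four `DualPair` fields descend along the free base quotient (B-p13 (g21)'s (E3), VERBATIM letter) -/

/-- **letter (Md3) `stub_F3Md3`** = B-p13 (g21)'s (E3) `exists_dualPair_fields_of_free_base_quotient′`
(`B-provers/B-p13/g21/F3Md/DualPairBaseQuotientDescentOfNoetherian.reportfirst.B-p13g21.lean`, GREEN zero-sorry in HOME over B-p06's
(Z2) seed; = ★ `DualPairBaseQuotientDescent.exists_dualPair_fields_of_free_base_quotient` with `[IsReduced D.hat.X.left]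
[IsLocallyNoetherian D.hat.X.left]` replaced by `[IsLocallyNoetherian S]`), statement copied token for token and closed by `∀`:
the dual pair `D` of `A/S` descends along the free finite base quotient `p : S → Q` to the four property fields of a dual pair of
`B/Q` on `(B̂, 𝒫_B)` together with the Poincaré clause `(π × π̂)^*𝒫_B ≅ 𝒫`.  When (E3) lands (★) this letter is discharged BY NAME.
[cite: MumfordFogartyKirwan1994, Ch. 7 §3, remark after Thm. 7.9 and Lemma 7.11 (pp. 139–140)]
[cite: MumfordFogartyKirwan1994, Ch. 6 §1 Cor. 6.8 (p. 118) and §2 (p. 121)] [cite: MumfordAV1970, §13 (p. 125)]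
[cite: MilneAV2008, I §8 pp. 36–37] [cite: SGA1, Exp. VIII Cor. 7.8] -/
theorem stub_F3Md3 : ∀ {S Q : Scheme.{0}} {p : S ⟶ Q} {G : Type} [Group G] [Fintype G] {ρ : ActionOver p G}
    (_hq : ρ.IsGeometricQuotient p) [IsAffineHom p]
    (_hfree : ∀ (V : Q.Opens), IsAffineOpen V → ∀ g : G, g ≠ 1 →
      Ideal.span (Set.range fun s : Γ(S, p ⁻¹ᵁ V) ↦ ρ.act g V s - s) = ⊤)
    (A : AbelianSchemeOver S) (D : A.DualPair)
    (B : AbelianSchemeOver Q) {π : A.X.left ⟶ B.X.left} (ρA : ActionOver π G) (hAB : A.IsBaseChangeVia B p π)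
    (hA : ∀ g : G, A.IsBaseChangeVia A (ρ.aut g).hom (ρA.aut g).hom)
    (Bh : AbelianSchemeOver Q) {πh : D.hat.X.left ⟶ Bh.X.left} (ρh : ActionOver πh G)
    (hABh : D.hat.IsBaseChangeVia Bh p πh)
    (hAh : ∀ g : G, D.hat.IsBaseChangeVia D.hat (ρ.aut g).hom (ρh.aut g).hom)
    [IsLocallyNoetherian S] [IsLocallyNoetherian Q] [LocallyOfFiniteType p] [Bh.X.left.IsSeparated]
    (_hP : ∀ g : G, Nonempty ((Scheme.Modules.pullback
      (pullback.map A.X.hom D.hat.X.hom A.X.hom D.hat.X.hom (ρA.aut g).hom (ρh.aut g).hom (ρ.aut g).hom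
        (hA g).fst.symm (hAh g).fst.symm)).obj D.P ≅ D.P)),
    ∃ PB : (B.prodLeft Bh).Modules, HasRank PB 1 ∧
      Nonempty ((Scheme.Modules.pullback (B.unitSlice Bh)).obj PB ≅ SheafOfModules.unit _) ∧
      (∀ (Ω : Type) [Field Ω] [IsAlgClosed Ω] (b : Spec (.of Ω) ⟶ Bh.X.left),
        IsHomogeneous (B.fibre (b ≫ Bh.X.hom)).toAbelianVariety
          ((Scheme.Modules.pullback (B.fibreSlice Bh b)).obj PB)) ∧
      (∀ {T : Scheme.{0}} (f : T ⟶ Q) (ℒ : B.RigidifiedLineBundle f), ℒ.FibrewisePicZero →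
        ∃! g : {g : T ⟶ Bh.X.left // g ≫ Bh.X.hom = f},
          Nonempty ((Scheme.Modules.pullback (B.baseChangeToProd Bh f g.1 g.2)).obj PB ≅ ℒ.L)) ∧
      Nonempty ((Scheme.Modules.pullback
        (pullback.map A.X.hom D.hat.X.hom B.X.hom Bh.X.hom π πh p hAB.fst.symm hABh.fst.symm)).obj PB ≅ D.P) := by
  intro S Q p G _ _ ρ hq _ hfree A D B π ρA hAB hA Bh πh ρh hABh hAh _ _ _ _ hP
  exact AbelianSchemeOver.exists_dualPair_fields_of_free_base_quotient' hq hfree A D B ρA hAB hA Bh ρh hABh hAh hP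

/-! ## §8 THE COMPOSITION `stub_F3M_of` — `stub_F3M` (tree :143, statement verbatim) PROVED from (Ma)(Mb)(Mc)(Md1)(Md2)(Md3) -/

/-- **`stub_F3M` FROM THE SECOND-LAYER LETTERS** (statement = tree `stub_F3M` :143 verbatim): split `K(L)` over the free finite
base quotient `p : S′ → Spec R` (Ma); build `(Â′, 𝒫′)` with the three property fields, the kernel clause and the socket (Mb); add
universality (Mc) — so `D′ := ⟨Â′, 𝒫′, …⟩` is a dual pair of `A ×_R S′`, hat-normalised by ★ `DualPair.normalize`; let `G` act on
the dual by uniqueness (Md1); descend the OBJECT `Â′/G =: B̂` (Md2) and the four fields (Md3); assemble `⟨B̂, 𝒫_B, …⟩ : A.DualPair`.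
[cite: MumfordAV1970, §13 Theorem (p. 125)] [cite: MumfordFogartyKirwan1994, Ch. 6 §1 Corollary 6.8 (p. 118) and §2 (p. 121)] -/
theorem stub_F3M_of (R : Type) [CommRing R] [IsNoetherianRing R] [Algebra ℚ R] [ConnectedSpace ↥(Spec (.of R))]
    (A : AbelianSchemeOver (Spec (.of R))) (hA : IsProjective A.X.hom) (L : A.left.Modules) (hL : HasRank L 1)
    (hε : CechPic.pullback A.unitSection (detClass (HasRank.isFiniteLocallyFree' hL)) = 1)
    (hΘ : ∀ ⦃Ω : Type⦄ [Field Ω] [IsAlgClosed Ω] (s : Spec (.of Ω) ⟶ Spec (.of R)),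
      ∃ Θ : CartierDivisor (A.fibre s).toAbelianVariety.X.left, Θ.IsAmple ∧
        CechPic.pullback (X := (A.fibre s).toAbelianVariety.X.left) (pullback.fst A.X.hom s)
          (detClass (HasRank.isFiniteLocallyFree' hL)) = Θ.cechClass)
    (hK : ∃ (Z : Over (Spec (.of R))) (i : Z ⟶ A.X) (_ : IsClosedImmersion i.left) (_ : IsFinite Z.hom) (_ : Etale Z.hom),
      ∀ (T : Over (Spec (.of R))) (u : T ⟶ A.X), (∃ v : T ⟶ Z, v ≫ i = u) ↔ A.MemKOfL L u) :
    Nonempty A.DualPair := by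
  classical
  obtain ⟨S', p, hS'aff, hS'noe, hpaff, hpfin, hplft, hpet, hpsurj, G, hGgrp, hGfin, ρ, ρA, hAB, hA₁, hq, hfree,
    K', hK'fin, hKinj, hK'⟩ := stub_F3Ma R A L hL hε hΘ hK
  have hA' : IsProjective (A.baseChange p).X.hom := by
    rw [AbelianSchemeOver.baseChange_hom]; exact hA.pullback_snd p
  obtain ⟨hat, π, hπmon, hπfin, hπet, hπsurj, P, hker, h1, hrig, hpic, hsock, hfinaff⟩ :=
    stub_F3Mb R A L hL hε hΘ p hA' K' hKinj hK'
  let D' : (A.baseChange p).DualPair :=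
    ⟨hat, P, h1, hrig, hpic, fun f ℒ hℒ =>
      stub_F3Mc R A L hL hε hΘ p hat π ⟨hπfin, hπet, hπsurj⟩ P hker h1 hrig hsock f ℒ hℒ⟩
  let D : (A.baseChange p).DualPair := D'.normalize
  have hunit : Nonempty ((Scheme.Modules.pullback (AbelianSchemeOver.DualPair.unitHatSlice D)).obj D.P ≅
      SheafOfModules.unit _) :=
    D'.nonempty_unitHatSlice_iso_normalize
  obtain ⟨ρh, hρh, hAh, hP⟩ := stub_F3Md1 ρ hq hfree (A.baseChange p) D A ρA hAB hA₁ hunit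
  have hfinaff' : ∀ F : Finset D.hat.X.left, ∃ U : D.hat.X.left.Opens, IsAffineOpen U ∧ ∀ x ∈ F, x ∈ U := hfinaff
  obtain ⟨Bh, πh, hinv, hABh, hsep⟩ := stub_F3Md2 ρ hq hfree D.hat hfinaff' ρh hρh hAh
  haveI := hsep
  let ρh' : ActionOver πh G := ⟨ρh.aut, hinv⟩
  obtain ⟨PB, hB1, hBrig, hBpic, hBuniv, -⟩ :=
    stub_F3Md3 hq hfree (A.baseChange p) D A ρA hAB hA₁ Bh ρh' hABh hAh hP
  exact ⟨⟨Bh, PB, hB1, hBrig, hBpic, fun f ℒ hℒ => hBuniv f ℒ hℒ⟩⟩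

/-- **HEAD `stub_F3M_holds`** — the tree letter `stub_F3M` VERBATIM (statement copied token for token from
`Cruxes/HDel/Lines/F3DualAbelianScheme.lean` :143–152 ed. 1.1, i.e. ed. 1 digest 693313dd + the binder `(_hA : IsProjective A.X.hom)`
right after `(A : …)` per B-plan1 (g19) 19:29:45Z + `[ConnectedSpace ↥(Spec (.of R))]` after `[Algebra ℚ R]` per 19:36:14Z = parent ed. 1.2),
discharged by the composition `stub_F3M_of`: the closing
prover of the parent stub writes `exact F3DualAbelianSchemeM.stub_F3M_holds`.  Modulo exactly the seven letters of this file.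
[cite: MumfordAV1970, §13 Theorem (p. 125)] [cite: MumfordFogartyKirwan1994, Ch. 6 §1 Corollary 6.8 (p. 118) and §2 (p. 121)] -/
theorem stub_F3M_holds : ∀ (R : Type) [CommRing R] [IsNoetherianRing R] [Algebra ℚ R] [ConnectedSpace ↥(Spec (.of R))]
    (A : AbelianSchemeOver (Spec (.of R)))
    (_hA : IsProjective A.X.hom) (L : A.left.Modules) (hL : HasRank L 1)
    (_hε : CechPic.pullback A.unitSection (detClass (HasRank.isFiniteLocallyFree' hL)) = 1)
    (_hΘ : ∀ ⦃Ω : Type⦄ [Field Ω] [IsAlgClosed Ω] (s : Spec (.of Ω) ⟶ Spec (.of R)),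
      ∃ Θ : CartierDivisor (A.fibre s).toAbelianVariety.X.left, Θ.IsAmple ∧
        CechPic.pullback (X := (A.fibre s).toAbelianVariety.X.left) (pullback.fst A.X.hom s)
          (detClass (HasRank.isFiniteLocallyFree' hL)) = Θ.cechClass)
    (_hK : ∃ (Z : Over (Spec (.of R))) (i : Z ⟶ A.X) (_ : IsClosedImmersion i.left) (_ : IsFinite Z.hom) (_ : Etale Z.hom),
      ∀ (T : Over (Spec (.of R))) (u : T ⟶ A.X), (∃ v : T ⟶ Z, v ≫ i = u) ↔ A.MemKOfL L u),
    Nonempty A.DualPair :=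
  fun R _ _ _ _ A hA L hL hε hΘ hK => stub_F3M_of R A hA L hL hε hΘ hK

end Summit.HodgeConjecture.CorCM.Cruxes.HypDel.F3DualAbelianSchemeM

end
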